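import Literature.MathematicalPhysics.QuantumFieldTheory.Balaban1983to89.B13Lemma3Torus
import Literature.MathematicalPhysics.QuantumFieldTheory.Balaban1983to89.B13CauchyDecay

/-!
# `Balaban1983to89.B13Lemma2Torus` — T. Bałaban, *Renormalization group approach to lattice gauge field theories.
II. Cluster expansions*, Commun. Math. Phys. **116** (1988) 1–22, doi:10.1007/bf01239022 [Balaban1988RG2Cluster]:
**LEMMA 2 (1.41)–(1.43) p. 11 ON THE TWO-SCALE TORUS** — the P^{(k)}-analysis of pp. 10–11 assembled on the papers'
periodic carrier `B13Lemma3Torus.TwoTorusStep 4 L N′`: the representation (1.42) `V_k(Y, B) = ½⟨Q(Y, B)B, B⟩ + V″_k(Y, B)`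
and the bound (1.43) on the matrix elements `Q(Y, B, b, b′)` are PROVED for the record's fields from per-cube scaled
cubic terms `g_k⁻²W(g_kB)` (the `1/g_k²`-terms of P^{(k)} localized in Y by (1.37)/(1.38)), the □-count `M⁻⁴|Y| = #Y`
and (2.30) `d_k(Y) ≤ M⁻⁴|Y| − 1` being THEOREMS of the torus; the most important term `(1/g_k²)V(H₁B′)` is fed from
the polydisc data of p. 10 (analyticity of the underintegral expression of (1.38) in σ(Y) on `|σ| ≤ e^{κ₁}` with the sup
bound «(33), (37), (55), (57), (58) [15]», by reference) through `B13CauchyDecay` / `B13PkScaling`; hence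
`B13.Lemma2Printed W.toStepData c` from Lemma 1, these located inputs and the printed gauge-invariance clause

statement-level skeleton of published theorems with citation tags; proofs where landed; nothing here is a claim about
the Yang–Mills mass gap

PDF held: `paper:balaban1988-cmp116-rg-ii-cluster` (journal page = PDF page + 0); pp. 10–11 re-read this session from the
text layer (`p0010.txt`, `p0011.txt`) AND from the render
`run/shared/lean/pub/pub-balaban/b2b-balaban-ref1/pages/1988-cmp116-rg-II-cluster/1988-cmp116-rg-II-cluster-p010-x2.png`
(the text layer drops the displays).

CITATION HEADER (verbatim, render p. 10 / text layer p. 11).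
* p. 10 [PDF 10]: *"It is connected with the factor 1/g_k² at many terms in this function. We have to cancel this factor,
  and this implies that we can get a bounded polynomial in B only, not the absolute bound of the type (1.36). Let us
  discuss it on the most important example of the expression (1/g_k²)V(H₁B′), where B′ is given by (I.3.2). … we obtain
  V(H₁B′) = Σ_□ V_□(H₁B′), (1.37) … The term corresponding to a domain Y is represented as
  Π_{Δ⊂Y∖□} ∫ds(Δ)(1/2πi)∫dσ(Δ)/(σ(Δ) − s(Δ))² V_□(σ(Y), H₁(σ(Y))B′). (1.38) … It is an analytic function of (U, J) in
  the space U^c_{k+1}(T_η, α′₀, α′₁), and of B′ in the domain {B′ : e^{16κ₁}|B′| ≦ a₁ on Y} … The underintegral expression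
  is analytic in σ(Y) on the polydisc |σ(Y)| ≦ e^{κ₁}. The estimates (33), (37), (55), (57), (58) [15] imply the bound
  |(1.38)| ≦ C₃(e^{16κ₁}|B′|)³M⁴exp(−(κ₁ − 1)M⁻⁴|Y∖□|), (1.39) where C₃ is an absolute constant. To cancel the factor 1/g_k²
  we expand (1.38) with respect to B′ up to the second order. The terms of zeroth and first order vanish, and the second
  order term is written as a quadratic form with coefficients given by second order derivatives of the function (1.38)."*
* p. 11 [PDF 11] l. 1–4: *"replaced by C₁ε₁. We fix a localization domain Y and we sum up all the expressions (1.38) with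
  the domain Y, i.e. we sum over all admissible □ ⊂ Y. This yields an expression satisfying the bounds (1.39), (1.40) with
  the additional factor M⁻⁴|Y| ≦ exp M⁻⁴|Y|."*; l. 5–10: *"The above analysis was done on the example of the expression
  (1/g_k²)V(H₁B′), but it can be done in the same way for all terms in P^{(k)}(g_k, U, J, B), and we obtain the same
  decompositions and bounds, possibly with other absolute constants. … Our last step is to sum up all the expressions with
  the same localization domain."*; Lemma 2: *"This function is a sum of two terms V_k(Y, B) = ½⟨Q(Y, B)B, B⟩ + V″_k(Y, B).
  (1.42) The first is a quadratic form in B, with an operator depending on B also. The matrix elements of the operator of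
  the quadratic form satisfy the bound |Q(Y, B, b, b′)| ≦ C₃ε₁M⁴ exp C₂κ₁ exp(−⅛(κ₁ − 1)d_k(Y) − ½(κ₁ − 1)M⁻⁴|Y|), (1.43)
  and the function V″_k(Y, B) satisfies the bound (1.36). The functions V_k(Y, U, J, B), and both terms in (1.42), are
  gauge invariant … Let us remark that the last statement is a simple consequence of the statement in Sect. I.3 … and of
  the fact that the operations in this section preserve the gauge invariance."* (gauge clause by assertion; cell GAPS
  G-B13-06).

WHAT IS REPRODUCED (cell `pub-ymgap`, HUMAN RULING D-0062 Track A, DAG node N10 = [B13], seat `pub-ymgap-dag-n10-b`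
(FIRST-MISSING-ESTIMATE twin of `pub-ymgap-dag-p2` = n10-a); a NEW LEAF over `B13Lemma3Torus` (the carrier
`TwoTorusStep`) and `B13CauchyDecay` (⊇ `B13PkScaling`, `B13Ineq140`, `B13Bound143OneShot`, `B13Term214`), nothing there
modified).  The abstract pieces of pp. 10–11 are ALREADY theorems of the tree — `B13PkScaling.quadraticForm_of_scaled_cubic`
(a `1/g_k²`-term with a cubic bound IS, on `g_k|B| < ε₁`, the quadratic form of an operator of norm `O(ε₁)`: Taylor at
order two, *"the terms of zeroth and first order vanish"*), `B13CauchyDecay.ineq139_of_polydisc_bound` /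
`analyticOnNhd_TopC_param` ((1.38) polydisc data ⇒ (1.39) + analyticity in `B′`), `B13Bound143.oneShot_exp` (the □-sum
rate, p. 11 l. 1–4) — but NO theorem concluded the statements of record `B13.Repr142` / `B13.Bound143` for a carrier;
the DAG knit `B13LeafTorus.b13_main_twoTorus` (n10-a) takes them as the hypotheses `hrepr`, `hQ`.  THIS FILE:
* §1 `sum_scaled_eq_half_sum`, `norm_two_mul_sum_Qop_le` (+ private `bilin_apply_sum_smul`) — a FINITE FAMILY of scaled cubic
  terms `g⁻²W_i(gx)` (the `1/g_k²`-terms of P^{(k)} with localization domain Y: one per admissible cube □ ⊂ Y and term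
  type) read in bond coordinates `x = Σ_b B(b)·e_b` (‖e_b‖ ≤ 1): on `|g|·‖x‖ < ε₁` their sum IS `½ Σ_{b,b′} Q(b, b′)B(b)B(b′)`
  with `Q(b, b′) := 2·Σ_i Qop(g⁻²W_i(g·))(x)(e_b, e_{b′})` ((1.42)), and `|Q(b, b′)| ≤ 27·#terms·K·ε₁` ((1.40)/(1.43)
  shape) [folklore + cite];
* §2 `qsum_rate_le` — the □-sum arithmetic of p. 11 l. 1–4 with `m` term types per cube: `#terms ≤ m·n`, `n = M⁻⁴|Y|`,
  per-term rate `e^{−(κ₁−1)(n−1)}` ((1.39)), `d_k(Y) ≤ n`, `κ₁ ≥ 11/3` ⇒ the printed exponential of (1.43) times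
  `27·m·K·e^{κ₁−1}·ε₁` (via `B13Bound143.oneShot_exp`; the implicit threshold 11/3 is subsumed by the printed R12,
  `B13Bound143.R25_of_R12`);
* §3 ON THE TORUS `W : TwoTorusStep 4 L N′` (𝐃_k = `tsys 4 (L·N′)`, the admissible □ ⊂ Y = the cubes `Y.1`, `#Y.1` of
  them, `d_k = torusTreeLen ≤ #Y.1 − 1` by `TreeLengthTorus.torusTreeLen_le_card_sub_one`): **`bound143_twoTorus`** —
  `B13.Bound143 W.toStepData c` VERBATIM from (i) the identification of the record's matrix elements with the □-sum of the
  per-term operators (`hQ`, definitional at a pin), (ii) per-term analyticity + cubic bounds with the (1.39)-rate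
  `K·e^{−(κ₁−1)(#Y−1)}` on a ball of radius `R ≥ 3ε₁` (by reference: [15] / [I] (2.12) — the located inputs), (iii) the
  space (1.34) read in coordinates (`hsp : |g_k|·‖B|_Y‖ < ε₁`), (iv) `volk Y = #Y.1` (= M⁻⁴|Y|), `κ₁ ≥ 11/3` and the FLOOR
  `27·m·K·e^{κ₁−1} ≤ C₃M⁴e^{C₂κ₁}` (print: *"possibly with other absolute constants"*, *"exp C₂κ₁"*);
  **`repr142_twoTorus`** — `B13.Repr142 W.toStepData` from the same data + `V_k(Y) := Σ_terms + V′_k(Y)` on (1.34) and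
  `V″_k := V′_k`; **`lemma2Printed_twoTorus`** — `B13.Lemma2Printed W.toStepData c` from `B13.Lemma1Printed` (n10-a's
  modules), the above, closure of the reader-owned `Analytic` under finite sums, per-term analyticity in (𝐔, 𝐉, B) on
  (1.34) (p. 10, by the considerations of the beginning of the section) and the gauge clause (by assertion).
* SIBLING `B13Lemma2TorusT7` (same seat, filed next): the per-term data (ii) for the most important term
  `(1/g_k²)V(H₁B′)` DERIVED from the polydisc data of p. 10 ((1.38) = `B′ ↦ TopC r l (Ψ B′) 0` over the `#Y − 1`
  parameters `σ(Δ)`, `Δ ⊂ Y∖□`; `Ψ B′` separately holomorphic on `U ⊇ {|σ| ≤ e^{κ₁}}`, analytic in `B′`, bounded by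
  `C₃(e^{16κ₁}‖B′‖)³M⁴` — [15], by reference; the field map (1.19) with (1.20)), and (1.43) on the torus for that family.
Discharged INSIDE (hypotheses of the abstract tree lemmas met by torus theorems): the □-count `#{□ ⊂ Y} = #Y.1 = M⁻⁴|Y|`
and (2.30) upper half `d_k(Y) ≤ M⁻⁴|Y|` (`torusTreeLen_le_card`); in the sibling also M⁻⁴|Y∖□| = #Y.1 − 1.
NO hypothesis restates (1.42) or (1.43): the conclusion's constants C₃, C₂, the rates ⅛(κ₁ − 1), ½(κ₁ − 1) and the
functions `V`, `Q`, `quadForm` of the record appear in no bound hypothesis.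

HONEST SCOPE.  (a) The P^{(k)}-terms enter as abstract per-cube functions of the fluctuation field on Y with the printed
order/analyticity properties (hypotheses, by reference to [15] and [I] (2.12); for T7 reduced in the sibling module to
the polydisc data of p. 10, for T3–T6 the census edges are `B13PkOrderEdges`, for the local T1/T2 `B13PkLocalTerms`);
the extension *"in the same way for all terms in P^{(k)}"* is print's assertion (cell GAPS G-adv9-20) — here it is the
finite term index `s Y` with `#(s Y) ≤ m·#Y`.  (b) As in `B13PkScaling` (cell DIVERGENCE D-b13.21) each whole scaled
term is put into quadratic form in `B` (Taylor in `B` of the composite `B ↦ g⁻²W(gB)`), `g` is a non-zero complex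
number, balls are open; the coordinate
vectors `e_b` and the reading `B|_Y = Σ_b B(b)e_b` are data of the pin (for the record: `E = (bonds ⊂ Y) → 𝔤ᶜ` with the sup
norm, `e_b` the unit coordinate vectors).  (c) NOT a discharge of node N10: the B13 group is FREE at NODE 00 Stages 1–3
(`Node00.CarriersFrame.carriers₁_groupB13`); this file turns the Lemma-2 hypotheses `hrepr`/`hQ`/`hVan` of the N10 knit
into located per-term inputs.  One finite T⁴ programme at fixed ε; Bałaban AS PRINTED; nothing continuum ∕ OS ∕ mass-gap ∕
Clay.  No `sorry`, no definition, no new named fact (D-0026); Mathlib + the two imported modules only.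
v1.1 (same seat, 2026-08-25; APPEND-ONLY, every v1 declaration byte-identical): §4 — LEMMA 2 WITHOUT THE READING
«V″_k := V′_k».  Print (p. 11) says only *"the function V″_k(Y, B) satisfies the bound (1.36)"*; by the cell's term census
(pub-balaban GAPS G-adv9-20 (c): *«T1, T2 have no 1/g_k² and are O(g_k|B|) = O(ε₁) per bond/coarse bond, so they go
wholly into V″_k»*) V″_k is V′_k PLUS the localized pieces of the strictly local terms of P^{(k)} (`B13PkLocalTerms`), so the
hypothesis `hVpp : Vpp = Vp` of `B13.lemma2_of_lemma1` / `lemma2Printed_twoTorus` is a special case.  `repr142_twoTorus'` and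
**`lemma2Printed_twoTorus'`** take instead `V_k(Y) = Σ_terms + V″_k(Y)` with (1.36) FOR V″_k (`B13.Bound136 … W.Vpp`) and
its analyticity as the inputs (Lemma 1 enters only through them); `bound136_of_split` is the bookkeeping that delivers
(1.36) for `V″ = V′ + (local pieces)` from (1.36)-type bounds with prefactors `(1 − θ)` and `θ` of the printed constant —
the headroom in *"There exist absolute constants C₁, C₂, q"*.

-/

/- Nested operator spaces `E →L[ℂ] E →L[ℂ] ℂ` (the quadratic-form operator `B13PkScaling.Qop`) need one more level of
pending instance synthesis than the default, as in `B13PkScaling` / `B13CauchyDecay`. -/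
set_option maxSynthPendingDepth 3

noncomputable section

namespace Literature.MathematicalPhysics.QuantumFieldTheory.Balaban1983to89.B13Lemma2Torus

open Metric Set
open Literature.MathematicalPhysics.QuantumFieldTheory.Balaban1983to89
open Literature.MathematicalPhysics.QuantumFieldTheory.Balaban1983to89.TreeLengthTorus
open Literature.MathematicalPhysics.QuantumFieldTheory.Balaban1983to89.B13Lemma3Torus (TwoTorusStep)
open Literature.MathematicalPhysics.QuantumFieldTheory.Balaban1983to89.B13PkScaling
  (Qop scaled quadraticForm_of_scaled_cubic norm_Qop_scaled_apply_le)
open Literature.MathematicalPhysics.QuantumFieldTheory.Balaban1983to89.B13Bound143 (oneShot_exp)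

/-! ## §1. A finite family of scaled cubic terms in bond coordinates: (1.42) and the (1.43)-shape -/

section QuadraticForm

variable {E : Type*} [NormedAddCommGroup E] [NormedSpace ℂ E]
variable {β : Type*} [Fintype β]

/-- A continuous bilinear form evaluated on a field written in bond coordinates, `x = Σ_b B(b)·e_b`:
`Q(x, x) = Σ_{b,b′} Q(e_b, e_{b′})·B(b)·B(b′)` — the matrix elements of (1.42)/(1.43) exhaust the quadratic form.
Private kernel plumbing. [folklore] -/
private theorem bilin_apply_sum_smul (Q : E →L[ℂ] E →L[ℂ] ℂ) (e : β → E) (B : β → ℂ) :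
    Q (∑ b, B b • e b) (∑ b, B b • e b) = ∑ b, ∑ b', Q (e b) (e b') * B b * B b' := by
  calc Q (∑ b, B b • e b) (∑ b, B b • e b)
      = ∑ b, (B b • Q (e b)) (∑ b', B b' • e b') := by
        rw [map_sum Q, FunLike.coe_sum, Finset.sum_apply]
        exact Finset.sum_congr rfl fun b _ => by rw [map_smul]
    _ = ∑ b, ∑ b', Q (e b) (e b') * B b * B b' := by
        refine Finset.sum_congr rfl fun b _ => ?_
        rw [FunLike.coe_smul, Pi.smul_apply, map_sum, smul_eq_mul, Finset.mul_sum]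
        refine Finset.sum_congr rfl fun b' _ => ?_
        rw [map_smul, smul_eq_mul]
        ring

/-- **(1.42) for a finite family of scaled cubic terms** (p. 10: *"To cancel the factor 1/g_k² we expand … up to the
second order. The terms of zeroth and first order vanish, and the second order term is written as a quadratic form"*;
p. 11: *"we sum over all admissible □ ⊂ Y"*, (1.42)).  Each `W_i` analytic on `‖z‖ < R` with a cubic bound there,
`3ε₁ ≤ R`; then on `|g|·‖x‖ < ε₁`, `x = Σ_b B(b)e_b`:
`Σ_i g⁻²W_i(gx) = ½ Σ_{b,b′} [2Σ_i Qop(g⁻²W_i(g·))(x)(e_b, e_{b′})] B(b)B(b′)` — per term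
`B13PkScaling.quadraticForm_of_scaled_cubic`, then `bilin_apply_sum_smul`. [cite: Balaban1988RG2Cluster, (1.42) p.11] -/
theorem sum_scaled_eq_half_sum {κ : Type*} (s : Finset κ) (W : κ → E → ℂ) {g : ℂ} (hg : g ≠ 0)
    {R ε₁ : ℝ} {K : κ → ℝ} (hK0 : ∀ i ∈ s, 0 ≤ K i) (hR : 0 < R)
    (hW : ∀ i ∈ s, AnalyticOnNhd ℂ (W i) (ball 0 R))
    (hK : ∀ i ∈ s, ∀ z ∈ ball (0 : E) R, ‖W i z‖ ≤ K i * ‖z‖ ^ 3) (h3 : 3 * ε₁ ≤ R)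
    (e : β → E) (B : β → ℂ) (hB : ‖g‖ * ‖∑ b, B b • e b‖ < ε₁) :
    ∑ i ∈ s, scaled g (W i) (∑ b, B b • e b) =
      (1 / 2 : ℂ) * ∑ b, ∑ b',
        (2 * ∑ i ∈ s, Qop (scaled g (W i)) (∑ b, B b • e b) (e b) (e b')) * B b * B b' := by
  set x : E := ∑ b, B b • e b with hx
  have hterm : ∀ i ∈ s, scaled g (W i) x = Qop (scaled g (W i)) x x x := fun i hi =>
    (quadraticForm_of_scaled_cubic hg (hK0 i hi) hR (hW i hi) (hK i hi) h3 hB).1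
  calc ∑ i ∈ s, scaled g (W i) x = ∑ i ∈ s, Qop (scaled g (W i)) x x x := Finset.sum_congr rfl hterm
    _ = ∑ i ∈ s, ∑ b, ∑ b', Qop (scaled g (W i)) x (e b) (e b') * B b * B b' :=
        Finset.sum_congr rfl fun i _ => by rw [hx]; exact bilin_apply_sum_smul _ e B
    _ = ∑ b, ∑ b', (∑ i ∈ s, Qop (scaled g (W i)) x (e b) (e b')) * B b * B b' := by
        rw [Finset.sum_comm]
        refine Finset.sum_congr rfl fun b _ => ?_
        rw [Finset.sum_comm]
        refine Finset.sum_congr rfl fun b' _ => ?_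
        rw [Finset.sum_mul, Finset.sum_mul]
    _ = (1 / 2 : ℂ) * ∑ b, ∑ b', (2 * ∑ i ∈ s, Qop (scaled g (W i)) x (e b) (e b')) * B b * B b' := by
        rw [Finset.mul_sum]
        refine Finset.sum_congr rfl fun b _ => ?_
        rw [Finset.mul_sum]
        refine Finset.sum_congr rfl fun b' _ => ?_
        ring

omit [Fintype β] in
/-- **The (1.40)/(1.43)-shape of the matrix elements of a finite family** (p. 10 (1.40): a bound LINEAR in the field;
p. 11 (1.43)): each `W_i` analytic with the cubic bound `K‖z‖³` on `‖z‖ < R`, `3ε₁ ≤ R`; on `|g|·‖x‖ ≤ ε₁` and for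
coordinate vectors `‖u‖, ‖v‖ ≤ 1`: `‖2Σ_{i∈s} Qop(g⁻²W_i(g·))(x)(u, v)‖ ≤ 27·#s·K·ε₁`
(`B13PkScaling.norm_Qop_scaled_apply_le` per term). [cite: Balaban1988RG2Cluster, (1.40) p.10, (1.43) p.11] -/
theorem norm_two_mul_sum_Qop_le {κ : Type*} (s : Finset κ) (W : κ → E → ℂ) {g : ℂ} (hg : g ≠ 0)
    {R ε₁ K : ℝ} (hK0 : 0 ≤ K) (hR : 0 < R)
    (hW : ∀ i ∈ s, AnalyticOnNhd ℂ (W i) (ball 0 R))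
    (hK : ∀ i ∈ s, ∀ z ∈ ball (0 : E) R, ‖W i z‖ ≤ K * ‖z‖ ^ 3) (h3 : 3 * ε₁ ≤ R)
    {x u v : E} (hx : ‖g‖ * ‖x‖ ≤ ε₁) (hu : ‖u‖ ≤ 1) (hv : ‖v‖ ≤ 1) :
    ‖2 * ∑ i ∈ s, Qop (scaled g (W i)) x u v‖ ≤ 27 * s.card * K * ε₁ := by
  have hε : 0 ≤ ε₁ := (mul_nonneg (norm_nonneg _) (norm_nonneg _)).trans hx
  have hterm : ∀ i ∈ s, ‖Qop (scaled g (W i)) x u v‖ ≤ 1 / 2 * (27 * K * ε₁) := by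
    intro i hi
    have h := norm_Qop_scaled_apply_le hg hK0 hR (hW i hi) (hK i hi) h3 hx u v
    calc ‖Qop (scaled g (W i)) x u v‖ ≤ 1 / 2 * (27 * K * ε₁) * ‖u‖ * ‖v‖ := h
      _ ≤ 1 / 2 * (27 * K * ε₁) * 1 * 1 := by gcongr
      _ = 1 / 2 * (27 * K * ε₁) := by ring
  calc ‖2 * ∑ i ∈ s, Qop (scaled g (W i)) x u v‖ = 2 * ‖∑ i ∈ s, Qop (scaled g (W i)) x u v‖ := by
        rw [norm_mul, Complex.norm_two]
    _ ≤ 2 * ∑ i ∈ s, ‖Qop (scaled g (W i)) x u v‖ := by gcongr; exact norm_sum_le _ _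
    _ ≤ 2 * ∑ i ∈ s, 1 / 2 * (27 * K * ε₁) := by gcongr with i hi; exact hterm i hi
    _ = 27 * s.card * K * ε₁ := by rw [Finset.sum_const, nsmul_eq_mul]; ring

end QuadraticForm

/-! ## §2. The □-sum arithmetic of p. 11 l. 1–4 with `m` term types -/

/-- **The □-sum rate** (p. 11 l. 1–4: *"we sum over all admissible □ ⊂ Y. This yields an expression satisfying the bounds
(1.39), (1.40) with the additional factor M⁻⁴|Y| ≦ exp M⁻⁴|Y|"*): with `n = M⁻⁴|Y| ≥ 0`, at most `N ≤ m·n` terms, the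
per-term (1.39)-rate `e^{−(κ₁−1)(n−1)}`, `d = d_k(Y) ≤ n` ((2.30)) and `κ₁ ≥ 11/3` (`B13Bound143.oneShot_exp`):
`27·N·(K e^{−(κ₁−1)(n−1)})·ε₁ ≤ 27·m·K·e^{κ₁−1}·ε₁ · exp(−(⅛(κ₁−1)d + ½(κ₁−1)n))` — the printed exponential of (1.43).
[cite: Balaban1988RG2Cluster, p.11 l.1–4, (1.43) p.11] -/
theorem qsum_rate_le {κ₁ K ε₁ m n d N : ℝ} (hK : 0 ≤ K) (hε : 0 ≤ ε₁) (hm : 0 ≤ m) (hκ : 11 / 3 ≤ κ₁)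
    (hn : 0 ≤ n) (hd : d ≤ n) (hN : N ≤ m * n) :
    27 * N * (K * Real.exp (-(κ₁ - 1) * (n - 1))) * ε₁ ≤
      27 * m * K * Real.exp (κ₁ - 1) * ε₁ * Real.exp (-((κ₁ - 1) / 8 * d + (κ₁ - 1) / 2 * n)) := by
  have hexp : n ≤ Real.exp n := by have := Real.add_one_le_exp n; linarith
  have h1 : N ≤ m * Real.exp n := hN.trans (mul_le_mul_of_nonneg_left hexp hm)
  have h2 := oneShot_exp hκ hn hd
  calc 27 * N * (K * Real.exp (-(κ₁ - 1) * (n - 1))) * ε₁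
      = N * (27 * (K * Real.exp (-(κ₁ - 1) * (n - 1)) * ε₁)) := by ring
    _ ≤ (m * Real.exp n) * (27 * (K * Real.exp (-(κ₁ - 1) * (n - 1)) * ε₁)) :=
        mul_le_mul_of_nonneg_right h1 (by positivity)
    _ = 27 * m * K * ε₁ * (Real.exp n * Real.exp (-(κ₁ - 1) * (n - 1))) := by ring
    _ ≤ 27 * m * K * ε₁ * (Real.exp (κ₁ - 1) * Real.exp (-((κ₁ - 1) / 8 * d + (κ₁ - 1) / 2 * n))) :=
        mul_le_mul_of_nonneg_left h2 (by positivity)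
    _ = 27 * m * K * Real.exp (κ₁ - 1) * ε₁ * Real.exp (-((κ₁ - 1) / 8 * d + (κ₁ - 1) / 2 * n)) := by ring

/-- Closure of an abstract analyticity predicate under finite sums (the silent step between p. 10 *"It is an analytic
function of (U, J) … and of B′"* per term and Lemma 2's *"defined and analytic on the space (1.34)"*).  Private kernel
plumbing, as in `B13Lemma1Assembly`. [folklore] -/
private theorem analytic_finset_sum {Φ : Type*} (An : (Φ → ℂ) → Set Φ → Prop) (s : Set Φ)
    (hAdd : ∀ f g, An f s → An g s → An (f + g) s) (hZero : An 0 s) {ι : Type*} (I : Finset ι)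
    (f : ι → Φ → ℂ) (h : ∀ i ∈ I, An (f i) s) : An (∑ i ∈ I, f i) s :=
  Finset.sum_induction f (fun g => An g s) (fun a b ha hb => hAdd a b ha hb) hZero h

/-! ## §3. Lemma 2 on the two-scale torus -/

section Torus

variable {L N' : ℕ} [NeZero L] [NeZero N']

/-- (2.30) upper half ON THE TORUS in the form used by the □-sum: `d_k(Y) ≤ M⁻⁴|Y|` (`= #Y.1`), from
`TreeLengthTorus.torusTreeLen_le_card_sub_one`. [cite: Balaban1988RG2Cluster, (2.30) p.18 (upper half)] -/
theorem torusTreeLen_le_card (Y : TDom 4 (L * N')) : torusTreeLen Y.1 ≤ (Y.1.card : ℝ) := by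
  have h := torusTreeLen_le_card_sub_one Y.2.1 Y.2.2
  linarith

/-- **(1.43) ON THE TWO-SCALE TORUS.**  Carrier `W : TwoTorusStep 4 L N′` (𝐃_k = the torus with `L·N′` cubes of side M per
direction), constants `c`.  DATA (what a pin of the B13 group supplies): a complex normed space `E` of fluctuation fields on
Y with coordinate vectors `e Y b` (`‖e Y b‖ ≤ 1`) and the reading `rd Y φ ∈ E` of the record's field `B` on Y; per
localization domain `Y` a finite index set `s Y` of `1/g_k²`-terms of P^{(k)} localized in Y (one per admissible cube □ ⊂ Y
and term type: `#(s Y) ≤ m·#Y.1`), each, at every configuration `φ` of the space (1.34) (through its (𝐔, 𝐉, B)), a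
function `W Y i φ : E → ℂ` of the fluctuation field ANALYTIC on `‖z‖ < R` with the CUBIC bound
`‖W Y i φ z‖ ≤ K e^{−(κ₁−1)(#Y.1−1)}‖z‖³` there, uniformly in `φ` (the (1.39)-type input: [15] (33), (37), (55), (57), (58)
and [I] (2.12), by reference — for the most important term see the sibling `B13Lemma2TorusT7`), `3ε₁ ≤ R`; the identification `hQ` of the record's
matrix elements `Q(Y, B, b, b′)` with `2Σ_{i∈s Y} Qop(g_k⁻²W_{Y,i}(g_k·))(rd Y φ)(e_b, e_{b′})` on the space (1.34)
(definitional at a pin); the space (1.34) read in coordinates, `|g_k|·‖rd Y φ‖ < ε₁` (*"{B : |B| < ε₁g_k⁻¹ on Y}"*, p. 9);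
`volk Y = #Y.1` (= M⁻⁴|Y|); `κ₁ ≥ 11/3` (⊂ printed R12, `B13Bound143.R25_of_R12`) and the FLOOR
`27·m·K·e^{κ₁−1} ≤ C₃M⁴e^{C₂κ₁}` (*"possibly with other absolute constants"*, *"exp C₂κ₁"*).  CONCLUSION: the typed
(1.43) `B13.Bound143 W.toStepData c`.  The □-count and (2.30) are theorems of the torus. [cite: Balaban1988RG2Cluster, (1.43) p.11] -/
theorem bound143_twoTorus (W : TwoTorusStep 4 L N') (c : B13.Consts)
    {E : Type*} [NormedAddCommGroup E] [NormedSpace ℂ E]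
    (rd : TDom 4 (L * N') → W.Φ → E) (e : TDom 4 (L * N') → W.Bond → E) (he : ∀ Y b, ‖e Y b‖ ≤ 1)
    {κ : Type*} (s : TDom 4 (L * N') → Finset κ) (Wf : TDom 4 (L * N') → κ → W.Φ → E → ℂ) {g : ℂ} (hg : g ≠ 0)
    {R K : ℝ} {m : ℕ} (hK0 : 0 ≤ K) (hR : 0 < R) (h3 : 3 * c.ε₁ ≤ R)
    (hW : ∀ Y, ∀ i ∈ s Y, ∀ φ ∈ W.sp1 Y, AnalyticOnNhd ℂ (Wf Y i φ) (ball 0 R))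
    (hK : ∀ Y, ∀ i ∈ s Y, ∀ φ ∈ W.sp1 Y, ∀ z ∈ ball (0 : E) R,
      ‖Wf Y i φ z‖ ≤ K * Real.exp (-(c.κ₁ - 1) * ((Y.1.card : ℝ) - 1)) * ‖z‖ ^ 3)
    (hcard : ∀ Y, (s Y).card ≤ m * Y.1.card)
    (hQ : ∀ Y φ (b b' : W.Bond), φ ∈ W.sp1 Y →
      W.Q Y φ b b' = 2 * ∑ i ∈ s Y, Qop (scaled g (Wf Y i φ)) (rd Y φ) (e Y b) (e Y b'))
    (hsp : ∀ Y φ, φ ∈ W.sp1 Y → ‖g‖ * ‖rd Y φ‖ < c.ε₁)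
    (hvolk : ∀ Y, W.volk Y = Y.1.card) (hκ₁ : 11 / 3 ≤ c.κ₁)
    (hfloor : 27 * m * K * Real.exp (c.κ₁ - 1) ≤ c.C₃ * c.M ^ 4 * Real.exp (c.C₂ * c.κ₁)) :
    B13.Bound143 W.toStepData c := by
  intro Y φ b b' hφ
  show ‖W.Q Y φ b b'‖ ≤ c.C₃ * c.ε₁ * c.M ^ 4 * Real.exp (c.C₂ * c.κ₁) *
    Real.exp (-((c.κ₁ - 1) / 8 * torusTreeLen Y.1 + (c.κ₁ - 1) / 2 * (W.volk Y : ℝ)))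
  rw [hvolk Y, hQ Y φ b b' hφ]
  have hsY := hsp Y φ hφ
  have hε : 0 ≤ c.ε₁ := ((mul_nonneg (norm_nonneg _) (norm_nonneg _)).trans_lt hsY).le
  have hKY : 0 ≤ K * Real.exp (-(c.κ₁ - 1) * ((Y.1.card : ℝ) - 1)) := by positivity
  have hme := norm_two_mul_sum_Qop_le (s Y) (fun i => Wf Y i φ) hg hKY hR (fun i hi => hW Y i hi φ hφ)
    (fun i hi => hK Y i hi φ hφ) h3 hsY.le (he Y b) (he Y b')
  have hN : ((s Y).card : ℝ) ≤ (m : ℝ) * (Y.1.card : ℝ) := by exact_mod_cast hcard Y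
  have harith := qsum_rate_le hK0 hε (Nat.cast_nonneg m) hκ₁ (Nat.cast_nonneg _) (torusTreeLen_le_card Y) hN
  refine (hme.trans harith).trans ?_
  have hX : 0 ≤ c.ε₁ * Real.exp (-((c.κ₁ - 1) / 8 * torusTreeLen Y.1 + (c.κ₁ - 1) / 2 * (Y.1.card : ℝ))) :=
    by positivity
  calc 27 * (m : ℝ) * K * Real.exp (c.κ₁ - 1) * c.ε₁ *
        Real.exp (-((c.κ₁ - 1) / 8 * torusTreeLen Y.1 + (c.κ₁ - 1) / 2 * (Y.1.card : ℝ)))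
      = (27 * m * K * Real.exp (c.κ₁ - 1)) *
          (c.ε₁ * Real.exp (-((c.κ₁ - 1) / 8 * torusTreeLen Y.1 + (c.κ₁ - 1) / 2 * (Y.1.card : ℝ)))) := by ring
    _ ≤ (c.C₃ * c.M ^ 4 * Real.exp (c.C₂ * c.κ₁)) *
          (c.ε₁ * Real.exp (-((c.κ₁ - 1) / 8 * torusTreeLen Y.1 + (c.κ₁ - 1) / 2 * (Y.1.card : ℝ)))) :=
        mul_le_mul_of_nonneg_right hfloor hX
    _ = c.C₃ * c.ε₁ * c.M ^ 4 * Real.exp (c.C₂ * c.κ₁) *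
          Real.exp (-((c.κ₁ - 1) / 8 * torusTreeLen Y.1 + (c.κ₁ - 1) / 2 * ((Y.1.card : ℕ) : ℝ))) := by
        ring

/-- **(1.42) ON THE TWO-SCALE TORUS.**  With the data of `bound143_twoTorus` (per-term cubic constants `K Y i ≥ 0` suffice
here), the reading of the field in coordinates `rd Y φ = Σ_b B(b)·e_{Y,b}` (`hrd`; `B(b) = W.Bv φ b`), the record's
`V_k(Y) = Σ_{i∈s Y} g_k⁻²W_{Y,i}(g_k·rd Y φ) + V′_k(Y)` on the space (1.34) (p. 11 *"Our last step is to sum up all the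
expressions with the same localization domain"* — definitional at a pin) and `V″_k := V′_k` (p. 11): the typed (1.42)
`B13.Repr142 W.toStepData` — `V_k(Y, B) = ½⟨Q(Y, B)B, B⟩ + V″_k(Y, B)` on (1.34). [cite: Balaban1988RG2Cluster, (1.42) p.11] -/
theorem repr142_twoTorus (W : TwoTorusStep 4 L N') (c : B13.Consts)
    {E : Type*} [NormedAddCommGroup E] [NormedSpace ℂ E]
    (rd : TDom 4 (L * N') → W.Φ → E) (e : TDom 4 (L * N') → W.Bond → E)
    (hrd : ∀ Y φ, rd Y φ = haveI := W.finBond; ∑ b, W.Bv φ b • e Y b)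
    {κ : Type*} (s : TDom 4 (L * N') → Finset κ) (Wf : TDom 4 (L * N') → κ → W.Φ → E → ℂ) {g : ℂ} (hg : g ≠ 0)
    {R : ℝ} {K : TDom 4 (L * N') → κ → ℝ} (hK0 : ∀ Y, ∀ i ∈ s Y, 0 ≤ K Y i) (hR : 0 < R) (h3 : 3 * c.ε₁ ≤ R)
    (hW : ∀ Y, ∀ i ∈ s Y, ∀ φ ∈ W.sp1 Y, AnalyticOnNhd ℂ (Wf Y i φ) (ball 0 R))
    (hK : ∀ Y, ∀ i ∈ s Y, ∀ φ ∈ W.sp1 Y, ∀ z ∈ ball (0 : E) R, ‖Wf Y i φ z‖ ≤ K Y i * ‖z‖ ^ 3)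
    (hV : ∀ Y φ, φ ∈ W.sp1 Y → W.V Y φ = (∑ i ∈ s Y, scaled g (Wf Y i φ) (rd Y φ)) + W.Vp Y φ)
    (hVpp : W.Vpp = W.Vp)
    (hQ : ∀ Y φ (b b' : W.Bond), φ ∈ W.sp1 Y →
      W.Q Y φ b b' = 2 * ∑ i ∈ s Y, Qop (scaled g (Wf Y i φ)) (rd Y φ) (e Y b) (e Y b'))
    (hsp : ∀ Y φ, φ ∈ W.sp1 Y → ‖g‖ * ‖rd Y φ‖ < c.ε₁) :
    B13.Repr142 W.toStepData := by
  letI : Fintype W.Bond := W.finBond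
  intro Y φ hφ
  show W.V Y φ = (1 / 2 : ℂ) * (∑ b, ∑ b', W.Q Y φ b b' * W.Bv φ b * W.Bv φ b') + W.Vpp Y φ
  rw [hV Y φ hφ, hVpp]
  congr 1
  have hsY := hsp Y φ hφ
  rw [hrd Y φ] at hsY ⊢
  rw [sum_scaled_eq_half_sum (s Y) (fun i => Wf Y i φ) hg (hK0 Y) hR (fun i hi => hW Y i hi φ hφ)
    (fun i hi => hK Y i hi φ hφ) h3 (e Y) (W.Bv φ) hsY]
  refine congrArg _ (Finset.sum_congr rfl fun b _ => Finset.sum_congr rfl fun b' _ => ?_)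
  rw [hQ Y φ b b' hφ, hrd Y φ]

/-- **LEMMA 2 ON THE TWO-SCALE TORUS** (p. 11, verbatim in the module header).  From Lemma 1 for the record
(`h1 : B13.Lemma1Printed W.toStepData c` — on the torus: n10-a's `B13Lemma1*Torus*` modules), `V″_k := V′_k`, the
per-term data of `bound143_twoTorus` / `repr142_twoTorus` (scaled cubic `1/g_k²`-terms of P^{(k)} per admissible cube and
term type, the coordinate reading of B on Y, the identifications `hV`/`hQ`, the space (1.34) in coordinates, `volk = #Y`,
`κ₁ ≥ 11/3`, the floor), the analyticity of each term as a function of (𝐔, 𝐉, B) on (1.34) (p. 10: *"It is an analytic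
function of (U, J) in the space U^c_{k+1}(T_η, α′₀, α′₁), and of B′ …"*, by reference to the beginning of Sect. 1) with the
closure of the reader-owned `Analytic` under `+`/`0` ([folklore]), and the gauge-invariance clause (*"a simple consequence
of the statement in Sect. I.3 … and of the fact that the operations in this section preserve the gauge invariance"* — by
assertion, cell GAPS G-B13-06): `B13.Lemma2Printed W.toStepData c` (via `B13.lemma2_of_lemma1`).
[cite: Balaban1988RG2Cluster, Lemma 2 (1.41)–(1.43) p.11] -/
theorem lemma2Printed_twoTorus (W : TwoTorusStep 4 L N') (c : B13.Consts)
    (h1 : B13.Lemma1Printed W.toStepData c) (hVpp : W.Vpp = W.Vp)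
    {E : Type*} [NormedAddCommGroup E] [NormedSpace ℂ E]
    (rd : TDom 4 (L * N') → W.Φ → E) (e : TDom 4 (L * N') → W.Bond → E) (he : ∀ Y b, ‖e Y b‖ ≤ 1)
    (hrd : ∀ Y φ, rd Y φ = haveI := W.finBond; ∑ b, W.Bv φ b • e Y b)
    {κ : Type*} (s : TDom 4 (L * N') → Finset κ) (Wf : TDom 4 (L * N') → κ → W.Φ → E → ℂ) {g : ℂ} (hg : g ≠ 0)
    {R K : ℝ} {m : ℕ} (hK0 : 0 ≤ K) (hR : 0 < R) (h3 : 3 * c.ε₁ ≤ R)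
    (hW : ∀ Y, ∀ i ∈ s Y, ∀ φ ∈ W.sp1 Y, AnalyticOnNhd ℂ (Wf Y i φ) (ball 0 R))
    (hK : ∀ Y, ∀ i ∈ s Y, ∀ φ ∈ W.sp1 Y, ∀ z ∈ ball (0 : E) R,
      ‖Wf Y i φ z‖ ≤ K * Real.exp (-(c.κ₁ - 1) * ((Y.1.card : ℝ) - 1)) * ‖z‖ ^ 3)
    (hcard : ∀ Y, (s Y).card ≤ m * Y.1.card)
    (hV : ∀ Y, W.V Y = fun φ => (∑ i ∈ s Y, scaled g (Wf Y i φ) (rd Y φ)) + W.Vp Y φ)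
    (hQ : ∀ Y φ (b b' : W.Bond), φ ∈ W.sp1 Y →
      W.Q Y φ b b' = 2 * ∑ i ∈ s Y, Qop (scaled g (Wf Y i φ)) (rd Y φ) (e Y b) (e Y b'))
    (hsp : ∀ Y φ, φ ∈ W.sp1 Y → ‖g‖ * ‖rd Y φ‖ < c.ε₁)
    (hvolk : ∀ Y, W.volk Y = Y.1.card) (hκ₁ : 11 / 3 ≤ c.κ₁)
    (hfloor : 27 * m * K * Real.exp (c.κ₁ - 1) ≤ c.C₃ * c.M ^ 4 * Real.exp (c.C₂ * c.κ₁))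
    -- analyticity: the terms as functions of (U, J, B) on (1.34); closure of the reader-owned predicate
    (hAdd : ∀ (S : Set W.Φ) (f f' : W.Φ → ℂ), W.Analytic f S → W.Analytic f' S → W.Analytic (f + f') S)
    (hZero : ∀ S : Set W.Φ, W.Analytic 0 S)
    (hAnP : ∀ Y, ∀ i ∈ s Y, W.Analytic (fun φ => scaled g (Wf Y i φ) (rd Y φ)) (W.sp1 Y))
    -- gauge invariance (by assertion in print)
    (hG : ∀ Y, W.GaugeInv (W.V Y) ∧ W.GaugeInv (W.toStepData.quadForm Y) ∧ W.GaugeInv (W.Vpp Y)) :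
    B13.Lemma2Printed W.toStepData c := by
  have hKY : ∀ Y : TDom 4 (L * N'), ∀ i ∈ s Y, 0 ≤ K * Real.exp (-(c.κ₁ - 1) * ((Y.1.card : ℝ) - 1)) :=
    fun Y _ _ => by positivity
  have hrepr : B13.Repr142 W.toStepData :=
    repr142_twoTorus W c rd e hrd s Wf hg hKY hR h3 hW hK (fun Y φ _ => by rw [hV Y]) hVpp hQ hsp
  have h143 : B13.Bound143 W.toStepData c :=
    bound143_twoTorus W c rd e he s Wf hg hK0 hR h3 hW hK hcard hQ hsp hvolk hκ₁ hfloor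
  have hVan : ∀ Y : TDom 4 (L * N'), W.Analytic (W.V Y) (W.sp1 Y) := by
    intro Y
    rw [hV Y]
    have hsum : W.Analytic (∑ i ∈ s Y, fun φ => scaled g (Wf Y i φ) (rd Y φ)) (W.sp1 Y) :=
      analytic_finset_sum W.Analytic (W.sp1 Y) (hAdd _) (hZero _) (s Y) _ (hAnP Y)
    have hadd := hAdd (W.sp1 Y) _ _ hsum (h1.1 Y)
    convert hadd using 1
    funext φ
    simp only [Pi.add_apply, Finset.sum_apply]
    rfl
  exact B13.lemma2_of_lemma1 W.toStepData c h1 (by exact hVpp) hrepr h143 hVan hG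

end Torus

/-! ## §4 (v1.1). Lemma 2 without the reading «V″_k := V′_k» -/

section TorusV11

variable {L N' : ℕ} [NeZero L] [NeZero N']

/-- **(1.36) for `V″_k = V′_k + (local pieces)` with headroom** (p. 11 *"the function V″_k(Y, B) satisfies the bound
(1.36)"*; cell census G-adv9-20 (c): the strictly local terms of P^{(k)} go into V″_k): if on the spaces (1.34) `F` obeys the
(1.36)-shape with prefactor `(1 − θ)·E₀ε₁C₁M^q e^{C₂κ₁}` and `G` with prefactor `θ·E₀ε₁C₁M^q e^{C₂κ₁}` (`0 ≤ θ`), then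
`F + G` obeys (1.36) `B13.Bound136 S c`. [cite: Balaban1988RG2Cluster, Lemma 2 p.11, (1.36) p.9] -/
theorem bound136_of_split (S : B13.StepData) (c : B13.Consts) (F G : S.Dk.Dom → S.Φ → ℂ) {θ : ℝ}
    (hF : ∀ Y φ, φ ∈ S.sp1 Y → ‖F Y φ‖ ≤ (1 - θ) * (c.E₀ * c.ε₁ * c.C₁ * c.M ^ c.q * Real.exp (c.C₂ * c.κ₁)) *
      Real.exp (-((1 - 2 * c.δ) * c.κ * S.Dk.dj Y)))
    (hG : ∀ Y φ, φ ∈ S.sp1 Y → ‖G Y φ‖ ≤ θ * (c.E₀ * c.ε₁ * c.C₁ * c.M ^ c.q * Real.exp (c.C₂ * c.κ₁)) *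
      Real.exp (-((1 - 2 * c.δ) * c.κ * S.Dk.dj Y))) :
    B13.Bound136 S c fun Y φ => F Y φ + G Y φ := by
  intro Y φ hφ
  calc ‖F Y φ + G Y φ‖ ≤ ‖F Y φ‖ + ‖G Y φ‖ := norm_add_le _ _
    _ ≤ _ := add_le_add (hF Y φ hφ) (hG Y φ hφ)
    _ = c.E₀ * c.ε₁ * c.C₁ * c.M ^ c.q * Real.exp (c.C₂ * c.κ₁) *
          Real.exp (-((1 - 2 * c.δ) * c.κ * S.Dk.dj Y)) := by ring

/-- **(1.42) on the two-scale torus, V″ general**: as `repr142_twoTorus` with the record's `V_k(Y) = Σ_{i∈s Y}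
g_k⁻²W_{Y,i}(g_k·rd Y φ) + V″_k(Y)` on the space (1.34) (`hV`) in place of `V = Σ + V′`, `V″ := V′`.
[cite: Balaban1988RG2Cluster, (1.42) p.11] -/
theorem repr142_twoTorus' (W : TwoTorusStep 4 L N') (c : B13.Consts)
    {E : Type*} [NormedAddCommGroup E] [NormedSpace ℂ E]
    (rd : TDom 4 (L * N') → W.Φ → E) (e : TDom 4 (L * N') → W.Bond → E)
    (hrd : ∀ Y φ, rd Y φ = haveI := W.finBond; ∑ b, W.Bv φ b • e Y b)
    {κ : Type*} (s : TDom 4 (L * N') → Finset κ) (Wf : TDom 4 (L * N') → κ → W.Φ → E → ℂ) {g : ℂ} (hg : g ≠ 0)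
    {R : ℝ} {K : TDom 4 (L * N') → κ → ℝ} (hK0 : ∀ Y, ∀ i ∈ s Y, 0 ≤ K Y i) (hR : 0 < R) (h3 : 3 * c.ε₁ ≤ R)
    (hW : ∀ Y, ∀ i ∈ s Y, ∀ φ ∈ W.sp1 Y, AnalyticOnNhd ℂ (Wf Y i φ) (ball 0 R))
    (hK : ∀ Y, ∀ i ∈ s Y, ∀ φ ∈ W.sp1 Y, ∀ z ∈ ball (0 : E) R, ‖Wf Y i φ z‖ ≤ K Y i * ‖z‖ ^ 3)
    (hV : ∀ Y φ, φ ∈ W.sp1 Y → W.V Y φ = (∑ i ∈ s Y, scaled g (Wf Y i φ) (rd Y φ)) + W.Vpp Y φ)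
    (hQ : ∀ Y φ (b b' : W.Bond), φ ∈ W.sp1 Y →
      W.Q Y φ b b' = 2 * ∑ i ∈ s Y, Qop (scaled g (Wf Y i φ)) (rd Y φ) (e Y b) (e Y b'))
    (hsp : ∀ Y φ, φ ∈ W.sp1 Y → ‖g‖ * ‖rd Y φ‖ < c.ε₁) :
    B13.Repr142 W.toStepData := by
  letI : Fintype W.Bond := W.finBond
  intro Y φ hφ
  show W.V Y φ = (1 / 2 : ℂ) * (∑ b, ∑ b', W.Q Y φ b b' * W.Bv φ b * W.Bv φ b') + W.Vpp Y φ
  rw [hV Y φ hφ]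
  congr 1
  have hsY := hsp Y φ hφ
  rw [hrd Y φ] at hsY ⊢
  rw [sum_scaled_eq_half_sum (s Y) (fun i => Wf Y i φ) hg (hK0 Y) hR (fun i hi => hW Y i hi φ hφ)
    (fun i hi => hK Y i hi φ hφ) h3 (e Y) (W.Bv φ) hsY]
  refine congrArg _ (Finset.sum_congr rfl fun b _ => Finset.sum_congr rfl fun b' _ => ?_)
  rw [hQ Y φ b b' hφ, hrd Y φ]

/-- **LEMMA 2 ON THE TWO-SCALE TORUS, V″ GENERAL** (p. 11).  As `lemma2Printed_twoTorus`, but the record's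
`V_k(Y) = Σ_{i∈s Y} g_k⁻²W_{Y,i}(g_k·) + V″_k(Y)` with `V″_k` ANY function satisfying (1.36) (`h136pp : B13.Bound136 … W.Vpp`
— for `V″ = V′ + (local pieces of T1, T2)`: Lemma 1 in pre-constant form + `B13PkLocalTerms` sizes via `bound136_of_split`)
and analytic on (1.34) (`hVppAn`); Lemma 1 is not an input of this statement (it enters through `h136pp`/`hVppAn`).
CONCLUSION: `B13.Lemma2Printed W.toStepData c`. [cite: Balaban1988RG2Cluster, Lemma 2 (1.41)–(1.43) p.11] -/
theorem lemma2Printed_twoTorus' (W : TwoTorusStep 4 L N') (c : B13.Consts)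
    (hVppAn : ∀ Y, W.Analytic (W.Vpp Y) (W.sp1 Y)) (h136pp : B13.Bound136 W.toStepData c W.Vpp)
    {E : Type*} [NormedAddCommGroup E] [NormedSpace ℂ E]
    (rd : TDom 4 (L * N') → W.Φ → E) (e : TDom 4 (L * N') → W.Bond → E) (he : ∀ Y b, ‖e Y b‖ ≤ 1)
    (hrd : ∀ Y φ, rd Y φ = haveI := W.finBond; ∑ b, W.Bv φ b • e Y b)
    {κ : Type*} (s : TDom 4 (L * N') → Finset κ) (Wf : TDom 4 (L * N') → κ → W.Φ → E → ℂ) {g : ℂ} (hg : g ≠ 0)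
    {R K : ℝ} {m : ℕ} (hK0 : 0 ≤ K) (hR : 0 < R) (h3 : 3 * c.ε₁ ≤ R)
    (hW : ∀ Y, ∀ i ∈ s Y, ∀ φ ∈ W.sp1 Y, AnalyticOnNhd ℂ (Wf Y i φ) (ball 0 R))
    (hK : ∀ Y, ∀ i ∈ s Y, ∀ φ ∈ W.sp1 Y, ∀ z ∈ ball (0 : E) R,
      ‖Wf Y i φ z‖ ≤ K * Real.exp (-(c.κ₁ - 1) * ((Y.1.card : ℝ) - 1)) * ‖z‖ ^ 3)
    (hcard : ∀ Y, (s Y).card ≤ m * Y.1.card)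
    (hV : ∀ Y, W.V Y = fun φ => (∑ i ∈ s Y, scaled g (Wf Y i φ) (rd Y φ)) + W.Vpp Y φ)
    (hQ : ∀ Y φ (b b' : W.Bond), φ ∈ W.sp1 Y →
      W.Q Y φ b b' = 2 * ∑ i ∈ s Y, Qop (scaled g (Wf Y i φ)) (rd Y φ) (e Y b) (e Y b'))
    (hsp : ∀ Y φ, φ ∈ W.sp1 Y → ‖g‖ * ‖rd Y φ‖ < c.ε₁)
    (hvolk : ∀ Y, W.volk Y = Y.1.card) (hκ₁ : 11 / 3 ≤ c.κ₁)
    (hfloor : 27 * m * K * Real.exp (c.κ₁ - 1) ≤ c.C₃ * c.M ^ 4 * Real.exp (c.C₂ * c.κ₁))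
    (hAdd : ∀ (S : Set W.Φ) (f f' : W.Φ → ℂ), W.Analytic f S → W.Analytic f' S → W.Analytic (f + f') S)
    (hZero : ∀ S : Set W.Φ, W.Analytic 0 S)
    (hAnP : ∀ Y, ∀ i ∈ s Y, W.Analytic (fun φ => scaled g (Wf Y i φ) (rd Y φ)) (W.sp1 Y))
    (hG : ∀ Y, W.GaugeInv (W.V Y) ∧ W.GaugeInv (W.toStepData.quadForm Y) ∧ W.GaugeInv (W.Vpp Y)) :
    B13.Lemma2Printed W.toStepData c := by
  have hKY : ∀ Y : TDom 4 (L * N'), ∀ i ∈ s Y, 0 ≤ K * Real.exp (-(c.κ₁ - 1) * ((Y.1.card : ℝ) - 1)) :=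
    fun Y _ _ => by positivity
  have hrepr : B13.Repr142 W.toStepData :=
    repr142_twoTorus' W c rd e hrd s Wf hg hKY hR h3 hW hK (fun Y φ _ => by rw [hV Y]) hQ hsp
  have h143 : B13.Bound143 W.toStepData c :=
    bound143_twoTorus W c rd e he s Wf hg hK0 hR h3 hW hK hcard hQ hsp hvolk hκ₁ hfloor
  have hVan : ∀ Y : TDom 4 (L * N'), W.Analytic (W.V Y) (W.sp1 Y) := by
    intro Y
    rw [hV Y]
    have hsum : W.Analytic (∑ i ∈ s Y, fun φ => scaled g (Wf Y i φ) (rd Y φ)) (W.sp1 Y) :=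
      analytic_finset_sum W.Analytic (W.sp1 Y) (hAdd _) (hZero _) (s Y) _ (hAnP Y)
    have hadd := hAdd (W.sp1 Y) _ _ hsum (hVppAn Y)
    convert hadd using 1
    funext φ
    simp only [Pi.add_apply, Finset.sum_apply]
  exact ⟨hVan, hrepr, h143, h136pp, hG⟩

end TorusV11

end Literature.MathematicalPhysics.QuantumFieldTheory.Balaban1983to89.B13Lemma2Torus

end
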